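import Summits.AtomisticToContinuum.FouriersLaw.Theorems.BondHeatUncertaintyBoundedResponseParityFloor
import Summits.AtomisticToContinuum.FouriersLaw.Theorems.OddSectorIrreversibilityOddDensityIsCorrector
import Summits.AtomisticToContinuum.FouriersLaw.Theorems.HonestZwanzigFeshbachIdentitiesResolventB
import Summits.AtomisticToContinuum.FouriersLaw.Theorems.BondHeatUncertaintySubdiffusiveBondHeatKernelDetailedBalance
import Summits.AtomisticToContinuum.FouriersLaw.Theorems.BoundaryEscapeDeficitBoundaryKernelBasics
import HarnessLib
import Summits.AtomisticToContinuum.FouriersLaw.Theorems.OddSectorIrreversibilityConeScaleCorrectorStubConeTransportBudgetContraction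

/-!
(SPLIT FOR THE 400-LINE CAP by the landing lane, hand-2 g35: this file = part 1 of 3; sequels `…BondHeatUncertaintyBoundedResponseParityFloorProofB`, `…BondHeatUncertaintyBoundedResponseParityFloorProof` import it in a chain; same namespace, all FQNs unchanged.)
# `OvershootParityFloor` — PROOF of the fixed-`N` parity floor (L) of node `ParityFloor`
(LANDING-LANE NOTE, hand-2 g35: the lemma `sq_facts` of the lens file — a verbatim twin of the tree's `…OddSectorIrreversibility.pinnedChain_integral_sq_act_le_of_stronglyMeasurable` — is CITED instead of restated (gate `dedup.landed`); its four uses in the sequel name the tree lemma; nothing else changed.)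

Decomposition cell `decomp-a2c`, lens «grading / quantitative ladder», generation 95, beneath
`Summits/AtomisticToContinuum/FouriersLaw/Theorems/BondHeatUncertaintyBoundedResponseParityFloor.lean` (generation 94,
in tree).  That file states the piece

  (L) `OvershootParityFloor` : for `N ≥ 2`, every response density `h` at `(N,T)` and every `t ≥ 0`,
      `escapeTransient_N(t) ≥ −(T²/(2γ))·oddDefect(μ_{N,T,T}) h`,

and proves the seam `11071 ⟸ (D) ∧ (K) ∧ (L) ∧ (L₂)` (`boundedResponse_of_deficitCesaroPoint_snapshot`).  THIS FILE PROVES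
(L) OUTRIGHT (`overshootParityFloor_holds`, §6), so the door of record becomes `11071 ⟸ (D) ∧ (K) ∧ (L₂)`
(`boundedResponse_of_deficitCesaroPoint_snapshotKL`, §6).

## The proof (all at fixed `N`, equilibrium `T_L = T_R = T`, `π = μ_T^N` the Gibbs measure)

Objects: `θ_b = p_b² − T` (`kinObs`), `v_t = P_t θ_b` (`kinAct`, constructed transition kernels), the Kubo corrector
`h_b = R₀θ_b = ∫_{(0,∞)} P_t θ_b dt` (`kinCorrector`; absolutely convergent pointwise by the Harris bound CEHR (2.5), `θ_b`
being centred), `Θ(q,p) = (q,−p)`.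

* §3 semigroup bookkeeping: Chapman–Kolmogorov `P_s v_u = v_{u+s}`; a Fubini lemma for `∫ F · (∫_S v_t dt) dν` with the
  DECAYING dominant `K C e^{ϑH} e^{−ct}` (so `S = (0,∞)` is allowed); the shift identity `P_t h₀ = h₀ − ∫₀ᵗ v_s ds`.
* §4 dynamics: detailed balance (`pinnedChain_detailedBalance`, ReyBellet Lemma 4.2) and `θ₀∘Θ = θ₀` give the
  time-reversed kernel `K_N(u+s) = ⟨v_s∘Θ, v_u⟩_π`, hence `∫_{(s,∞)} K_N = ⟨v_s∘Θ, h₀⟩_π` and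
  `∫₀ᵗ ∫_{(s,∞)} K_N ds = ⟨h₀∘Θ, h₀ − P_t h₀⟩_π ≥ ⟨h₀∘Θ, h₀⟩ − ‖h₀‖² = −½‖h₀ − h₀∘Θ‖²` (`L²(π)`-contraction of `P_t`,
  `Θ`-invariance of `π`); with `escapeTransient_N(t) = (γ/T²)∫₀ᵗ ∫_{(s,∞)} K_N ds` (`integral_transient_eq`):
  `escapeTransient_N(t) ≥ −(γ/(2T²)) ∫ (h₀ − h₀∘Θ)² dπ` (`escapeTransient_ge`).
* §5 statics: the response density is `h = ⟨h⟩ + (R₀g)∘Θ` a.e., `g = γ(p₀² − p_{N−1}²)/(2T²)`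
  (`pinnedChain_response_identification`, in tree), so `R₀g = (γ/(2T²))(h₀ − h_{N−1})`; the Kubo coboundary
  `R₀(LH) = ⟨H⟩ − H` a.e. (resolvent coboundary + Abel limit, the tree's template for `Ψ = H`) with
  `LH = −γ(θ₀ + θ_{N−1})` makes `h₀ + h_{N−1}` `Θ`-even a.e.; hence `h − h∘Θ = (γ/T²)(h₀∘Θ − h₀)` a.e. and
  `oddDefect π h = (γ²/T⁴) ∫ (h₀ − h₀∘Θ)² dπ` (`oddDefect_eq_of_isResponseDensity`).
* §6: (L), and the three-piece door.

No `sorry`, no new axioms; imports only tree modules; restates nothing (the frame `UniqueNESS`, `IsSteadyFamily`,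
`IsResponseDensity`, `oddDefect`, `OvershootParityFloor`, `SnapshotKLLowerExpansion` are the tree's, namespace
`…Theorems.BoundedResponse.ParityFloor`).

References: [cite: CuneoEckmannHairerReyBellet2018, Thm 2.13] (Harris bound, kernels); [cite: ReyBellet2006, Lemma 4.2]
(detailed balance); [cite: KunduDharNarayan2009, eqs. (reln2)–(reln3)] (response density = Kubo corrector);
[cite: MaesNetocny2010, Thm 3.1].
-/

noncomputable section

open MeasureTheory ProbabilityTheory Filter Topology Set Function
open scoped NNReal ENNReal ContDiff
open Literature.MathematicalPhysics.KineticTheory.HeatConduction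
open Literature.MathematicalPhysics.KineticTheory OscillatorChain
open Summit.AtomisticToContinuum.FouriersLaw.Theorems.SubdiffusiveBondHeat
open Summit.AtomisticToContinuum.FouriersLaw.Theorems.OddSectorIrreversibility
open Summit.AtomisticToContinuum.FouriersLaw.Theorems.ExtensiveSnapshotIrreversibility.ClausiusBudget
open Summit.AtomisticToContinuum.FouriersLaw.Theorems.HonestZwanzig
open Summit.AtomisticToContinuum.FouriersLaw.Theorems.BoundedResponse.TransientBand
open Summit.AtomisticToContinuum.FouriersLaw.Cruxes.SuperadditiveResistance.FloatingProbeBypassLaplacian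

namespace Summit.AtomisticToContinuum.FouriersLaw.Theorems.BoundedResponse.ParityFloor

open Summit.AtomisticToContinuum.FouriersLaw.Theses.BondHeatUncertainty (BoundedResponse ExtensiveSnapshotIrreversibility)
open Summit.AtomisticToContinuum.FouriersLaw.Theorems.SubdiffusiveBondHeat.EscapeGrading (OhmicFloor ExponentFloor)
open Summit.AtomisticToContinuum.FouriersLaw.Theorems.BoundedResponse.TransientBand
  (DeficitCesaroPoint TransientFloor DeficitCesaroGrade)

variable {N : ℕ}

/-! ## §1 Objects -/

/-- The centred kinetic observable `θ_b(q,p) = p_b² − T` of site `b`. [folklore] -/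
def kinObs (T : ℝ) (N : ℕ) (b : Fin N) (z : PhaseSpace N) : ℝ := z.2 b ^ 2 - T

/-- `v_t = P_{t⁺} θ_b`, the kinetic observable propagated by the constructed transition kernel at equal bath
temperatures `T` (for `t < 0` this is `θ_b` itself). [folklore] -/
def kinAct (ω₂ lam β γ T : ℝ) (N : ℕ) (b : Fin N) (t : ℝ) (z : PhaseSpace N) : ℝ :=
  ∫ y, kinObs T N b y ∂((pinnedChain ω₂ lam β γ).transitionKernel N T T t.toNNReal z)

/-- The Kubo corrector `h_b = R₀ θ_b = ∫_{(0,∞)} P_t θ_b dt` (pointwise absolutely convergent). [folklore] -/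
def kinCorrector (ω₂ lam β γ T : ℝ) (N : ℕ) (b : Fin N) (z : PhaseSpace N) : ℝ :=
  ∫ t in Ioi (0 : ℝ), kinAct ω₂ lam β γ T N b t z

/-! ## §2 Statics of `θ_b` and the Harris package -/

/-- `θ_b` is continuous. [folklore] -/
theorem continuous_kinObs (T : ℝ) (b : Fin N) : Continuous (kinObs T N b) := by
  unfold kinObs; fun_prop

/-- `θ_b ∘ Θ = θ_b`. [folklore] -/
theorem kinObs_reversal (T : ℝ) (b : Fin N) (z : PhaseSpace N) : kinObs T N b (z.1, -z.2) = kinObs T N b z := by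
  simp only [kinObs, Pi.neg_apply, neg_sq]

section Pinned

variable {ω₂ lam β γ T : ℝ}

/-- `|θ_b| ≤ (2/ϑ + T) e^{ϑH}`. [folklore] -/
theorem abs_kinObs_le (hω : 0 < ω₂) (hl : 0 ≤ lam) (hβ : 0 ≤ β) (hT : 0 ≤ T) {ϑ : ℝ} (hϑ : 0 < ϑ)
    (b : Fin N) (y : PhaseSpace N) :
    |kinObs T N b y| ≤ (2 / ϑ + T) * Real.exp (ϑ * (pinnedChain ω₂ lam β γ).hamiltonian N y) :=
  abs_sq_momentum_sub_le_exp hω hl hβ hϑ hT y b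

/-- `∫ θ_b dμ_T = 0`. [folklore] -/
theorem integral_kinObs (hω : 0 < ω₂) (hl : 0 ≤ lam) (hβ : 0 ≤ β) (hT : 0 < T) (b : Fin N) :
    ∫ z, kinObs T N b z ∂((pinnedChain ω₂ lam β γ).gibbsMeasure N T) = 0 :=
  pinnedChain_integral_kinObs_gibbsMeasure hω hl hβ γ N hT b

/-- The Harris package at weight `ϑ ∈ (0, 1/T)`: constants `K, c > 0` with the Harris bound (CEHR (2.5)) in the shape threaded through the tree's Kubo toolkit. [cite: CuneoEckmannHairerReyBellet2018, Thm 2.13] -/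
theorem harrisBound_exists (hω : 0 < ω₂) (hl : 0 ≤ lam) (hβ : 0 < β) (hγ : 0 < γ) (hN : 0 < N) (hT : 0 < T)
    {ϑ : ℝ} (hϑ0 : 0 < ϑ) (hϑ1 : ϑ < 1 / T) :
    ∃ K c : ℝ, 0 < K ∧ 0 < c ∧
      ∀ (z : PhaseSpace N) (t : ℝ≥0) (f : PhaseSpace N → ℝ), Continuous f → ∀ C : ℝ, 0 ≤ C →
      (∀ y, |f y| ≤ C * Real.exp (ϑ * (pinnedChain ω₂ lam β γ).hamiltonian N y)) →
      |(∫ y, f y ∂((pinnedChain ω₂ lam β γ).transitionKernel N T T t z)) -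
          ∫ y, f y ∂((pinnedChain ω₂ lam β γ).gibbsMeasure N T)| ≤
        K * C * Real.exp (ϑ * (pinnedChain ω₂ lam β γ).hamiltonian N z) * Real.exp (-c * t) :=
  pinnedChain_harris_bound hω hl hβ hγ hN hT hϑ0 hϑ1

/-- `v_t` is strongly measurable (every real `t`). [folklore] -/
theorem stronglyMeasurable_kinAct (ω₂ lam β γ T : ℝ) (b : Fin N) (t : ℝ) :
    StronglyMeasurable (kinAct ω₂ lam β γ T N b t) :=
  (continuous_kinObs T b).stronglyMeasurable.integral_kernel
    (κ := (pinnedChain ω₂ lam β γ).transitionKernel N T T t.toNNReal)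

/-- **Decay of `v_t`**: `|v_t(z)| ≤ K(2/ϑ+T) e^{ϑH(z)} e^{−c t⁺}` for EVERY real `t` (`θ_b` is centred). [folklore] -/
theorem abs_kinAct_le (hω : 0 < ω₂) (hl : 0 ≤ lam) (hβ : 0 ≤ β) (hT : 0 < T) {ϑ K c : ℝ} (hϑ0 : 0 < ϑ)
    (hb : ∀ (z : PhaseSpace N) (t : ℝ≥0) (f : PhaseSpace N → ℝ), Continuous f → ∀ C : ℝ, 0 ≤ C →
      (∀ y, |f y| ≤ C * Real.exp (ϑ * (pinnedChain ω₂ lam β γ).hamiltonian N y)) →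
      |(∫ y, f y ∂((pinnedChain ω₂ lam β γ).transitionKernel N T T t z)) -
          ∫ y, f y ∂((pinnedChain ω₂ lam β γ).gibbsMeasure N T)| ≤
        K * C * Real.exp (ϑ * (pinnedChain ω₂ lam β γ).hamiltonian N z) * Real.exp (-c * t)) (b : Fin N) (t : ℝ) (z : PhaseSpace N) :
    |kinAct ω₂ lam β γ T N b t z| ≤
      K * (2 / ϑ + T) * Real.exp (ϑ * (pinnedChain ω₂ lam β γ).hamiltonian N z) * Real.exp (-c * (t.toNNReal : ℝ)) := by
  have h := hb z t.toNNReal (kinObs T N b) (continuous_kinObs T b) _ (by positivity)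
    (fun y => abs_kinObs_le hω hl hβ hT.le hϑ0 b y)
  rw [integral_kinObs hω hl hβ hT b, sub_zero] at h
  exact h

/-- **The Kubo integral of `θ_b` converges absolutely**: `t ↦ v_t(z)` is integrable on `(0,∞)`, with the decay bound for
`t ≥ 0`. [folklore] -/
theorem kinAct_integrableOn (hω : 0 < ω₂) (hl : 0 ≤ lam) (hβ : 0 < β) (hγ : 0 < γ) (hT : 0 < T) {ϑ K c : ℝ}
    (hϑ0 : 0 < ϑ) (hb : ∀ (z : PhaseSpace N) (t : ℝ≥0) (f : PhaseSpace N → ℝ), Continuous f → ∀ C : ℝ, 0 ≤ C →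
      (∀ y, |f y| ≤ C * Real.exp (ϑ * (pinnedChain ω₂ lam β γ).hamiltonian N y)) →
      |(∫ y, f y ∂((pinnedChain ω₂ lam β γ).transitionKernel N T T t z)) -
          ∫ y, f y ∂((pinnedChain ω₂ lam β γ).gibbsMeasure N T)| ≤
        K * C * Real.exp (ϑ * (pinnedChain ω₂ lam β γ).hamiltonian N z) * Real.exp (-c * t)) (hc : 0 < c) (b : Fin N) (z : PhaseSpace N) :
    IntegrableOn (fun t => kinAct ω₂ lam β γ T N b t z) (Ioi 0) ∧
    ∀ t : ℝ, 0 ≤ t → |kinAct ω₂ lam β γ T N b t z| ≤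
      K * (2 / ϑ + T) * Real.exp (ϑ * (pinnedChain ω₂ lam β γ).hamiltonian N z) * Real.exp (-c * t) :=
  pinnedChain_integrableOn_kubo hω hl hβ hγ hb hc (continuous_kinObs T b) (by positivity)
    (fun y => abs_kinObs_le hω hl hβ.le hT.le hϑ0 b y) (integral_kinObs hω hl hβ.le hT b) z

/-- `h_b` is strongly measurable. [folklore] -/
theorem stronglyMeasurable_kinCorrector (hω : 0 < ω₂) (hl : 0 ≤ lam) (hβ : 0 ≤ β) (hγ : 0 ≤ γ) (T : ℝ) (b : Fin N) :
    StronglyMeasurable (kinCorrector ω₂ lam β γ T N b) :=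
  pinnedChain_stronglyMeasurable_kubo hω hl hβ hγ T T (continuous_kinObs T b).measurable

/-- `|h_b(z)| ≤ (K(2/ϑ+T)/c) e^{ϑH(z)}`. [folklore] -/
theorem abs_kinCorrector_le (hω : 0 < ω₂) (hl : 0 ≤ lam) (hβ : 0 < β) (hγ : 0 < γ) (hT : 0 < T) {ϑ K c : ℝ}
    (hϑ0 : 0 < ϑ) (hb : ∀ (z : PhaseSpace N) (t : ℝ≥0) (f : PhaseSpace N → ℝ), Continuous f → ∀ C : ℝ, 0 ≤ C →
      (∀ y, |f y| ≤ C * Real.exp (ϑ * (pinnedChain ω₂ lam β γ).hamiltonian N y)) →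
      |(∫ y, f y ∂((pinnedChain ω₂ lam β γ).transitionKernel N T T t z)) -
          ∫ y, f y ∂((pinnedChain ω₂ lam β γ).gibbsMeasure N T)| ≤
        K * C * Real.exp (ϑ * (pinnedChain ω₂ lam β γ).hamiltonian N z) * Real.exp (-c * t)) (hc : 0 < c) (b : Fin N) (z : PhaseSpace N) :
    |kinCorrector ω₂ lam β γ T N b z| ≤
      K * (2 / ϑ + T) / c * Real.exp (ϑ * (pinnedChain ω₂ lam β γ).hamiltonian N z) :=
  (pinnedChain_abs_kubo_le hω hl hβ hγ hb hc (continuous_kinObs T b) (by positivity)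
    (fun y => abs_kinObs_le hω hl hβ.le hT.le hϑ0 b y) (integral_kinObs hω hl hβ.le hT b) z).trans_eq (by ring)

/-! ## §3 Semigroup bookkeeping: Chapman–Kolmogorov, Fubini with a decaying dominant, the shift identity -/

/-- **Chapman–Kolmogorov for `θ_b`**: `P_s v_u = v_{u+s}` pointwise (`u, s ≥ 0`). [folklore] -/
theorem act_kinAct_eq (hω : 0 < ω₂) (hl : 0 ≤ lam) (hβ : 0 ≤ β) (hγ : 0 ≤ γ) (hN : 0 < N) (hT : 0 < T)
    (b : Fin N) {u s : ℝ} (hu : 0 ≤ u) (hs : 0 ≤ s) (z : PhaseSpace N) :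
    ∫ y, kinAct ω₂ lam β γ T N b u y ∂((pinnedChain ω₂ lam β γ).transitionKernel N T T s.toNNReal z) =
      kinAct ω₂ lam β γ T N b (u + s) z := by
  have hϑ0 : (0 : ℝ) < 1 / (4 * T) := by positivity
  have hϑ1 : 1 / (4 * T) < 1 / T := by
    rw [one_div_lt_one_div (by positivity) hT]; linarith
  unfold kinAct
  rw [pinnedChain_act_act_eq_nice hω hl hN hT hβ hγ hϑ0 hϑ1 (continuous_kinObs T b)
    (fun y => abs_kinObs_le hω hl hβ hT.le hϑ0 b y), Real.toNNReal_add hu hs, add_comm (s.toNNReal) (u.toNNReal)]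

/-- **Fubini with the decaying dominant.** For a finite measure `ν` integrating `e^{2ϑH}`, a strongly measurable `F` with
`F² ∈ L¹(ν)`, and `S ⊆ (0,∞)`: `∫ F(z) (∫_S v_t(z) dt) dν = ∫_S (∫ F v_t dν) dt` — domination
`|F||v_t| ≤ K(2/ϑ+T)·(F² + e^{2ϑH})/2 · e^{−ct⁺}`, integrable on `ν ⊗ dt|_S` because `θ_b` is centred. [folklore] -/
theorem integral_mul_setIntegral_kinAct (hω : 0 < ω₂) (hl : 0 ≤ lam) (hβ : 0 ≤ β) (hγ : 0 ≤ γ) (hT : 0 < T)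
    {ϑ K c : ℝ} (hϑ0 : 0 < ϑ) (hK : 0 ≤ K) (hb : ∀ (z : PhaseSpace N) (t : ℝ≥0) (f : PhaseSpace N → ℝ), Continuous f → ∀ C : ℝ, 0 ≤ C →
      (∀ y, |f y| ≤ C * Real.exp (ϑ * (pinnedChain ω₂ lam β γ).hamiltonian N y)) →
      |(∫ y, f y ∂((pinnedChain ω₂ lam β γ).transitionKernel N T T t z)) -
          ∫ y, f y ∂((pinnedChain ω₂ lam β γ).gibbsMeasure N T)| ≤
        K * C * Real.exp (ϑ * (pinnedChain ω₂ lam β γ).hamiltonian N z) * Real.exp (-c * t)) (hc : 0 < c) (b : Fin N)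
    (ν : Measure (PhaseSpace N)) [IsFiniteMeasure ν]
    (hν : Integrable (fun y => Real.exp (2 * ϑ * (pinnedChain ω₂ lam β γ).hamiltonian N y)) ν)
    {F : PhaseSpace N → ℝ} (hFm : StronglyMeasurable F) (hF2 : Integrable (fun z => F z ^ 2) ν)
    {S : Set ℝ} (hS : S ⊆ Ioi 0) :
    ∫ z, F z * (∫ t in S, kinAct ω₂ lam β γ T N b t z) ∂ν =
      ∫ t in S, ∫ z, F z * kinAct ω₂ lam β γ T N b t z ∂ν := by
  set P := pinnedChain ω₂ lam β γ with hP
  -- the weight `w(t) = e^{-c t⁺}` is integrable on `S`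
  have hw2 : IntegrableOn (fun t : ℝ => Real.exp (-c * (t.toNNReal : ℝ))) (Ioi 0) :=
    (exp_neg_integrableOn_Ioi 0 hc).congr_fun (fun t ht => by
      rw [Real.coe_toNNReal _ (le_of_lt (show (0 : ℝ) < t from ht))]) measurableSet_Ioi
  have hwS : IntegrableOn (fun t : ℝ => Real.exp (-c * (t.toNNReal : ℝ))) S := hw2.mono_set hS
  -- joint measurability of `(z, t) ↦ F z * v_t z`
  have hjm : AEStronglyMeasurable (uncurry fun z t => F z * kinAct ω₂ lam β γ T N b t z)
      (ν.prod (volume.restrict S)) := by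
    have h1 := (pinnedChain_stronglyMeasurable_act_uncurry hω hl hβ hγ T T (N := N)
      (continuous_kinObs T b).measurable).comp_measurable
      (measurable_swap : Measurable fun q : PhaseSpace N × ℝ => q.swap)
    have h2 : StronglyMeasurable fun q : PhaseSpace N × ℝ => F q.1 := hFm.comp_measurable measurable_fst
    exact (h2.mul h1).aestronglyMeasurable
  -- the dominating product
  have hwint : Integrable (fun z => K * (2 / ϑ + T) * ((F z ^ 2 + Real.exp (2 * ϑ * P.hamiltonian N z)) / 2)) ν :=
    ((hF2.add hν).div_const 2).const_mul _
  have hKC : 0 ≤ K * (2 / ϑ + T) := by positivity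
  have hprod : Integrable (uncurry fun z t => F z * kinAct ω₂ lam β γ T N b t z) (ν.prod (volume.restrict S)) := by
    refine Integrable.mono' (hwint.mul_prod hwS) hjm (Eventually.of_forall fun q => ?_)
    rcases q with ⟨z, t⟩
    simp only [uncurry]
    rw [norm_mul, Real.norm_eq_abs, Real.norm_eq_abs]
    have h1 := abs_kinAct_le hω hl hβ hT hϑ0 hb b t z
    have hE : Real.exp (ϑ * P.hamiltonian N z) ^ 2 = Real.exp (2 * ϑ * P.hamiltonian N z) := by
      rw [← Real.exp_nat_mul]; ring_nf
    have hAM : |F z| * Real.exp (ϑ * P.hamiltonian N z) ≤ (F z ^ 2 + Real.exp (2 * ϑ * P.hamiltonian N z)) / 2 := by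
      rw [← hE]
      nlinarith [sq_nonneg (|F z| - Real.exp (ϑ * P.hamiltonian N z)), sq_abs (F z)]
    have hw0 : 0 ≤ Real.exp (-c * ((t.toNNReal : ℝ≥0) : ℝ)) := (Real.exp_pos _).le
    calc |F z| * |kinAct ω₂ lam β γ T N b t z|
        ≤ |F z| * (K * (2 / ϑ + T) * Real.exp (ϑ * P.hamiltonian N z) * Real.exp (-c * (t.toNNReal : ℝ))) := by
          gcongr
      _ = K * (2 / ϑ + T) * (|F z| * Real.exp (ϑ * P.hamiltonian N z)) * Real.exp (-c * (t.toNNReal : ℝ)) := by ring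
      _ ≤ K * (2 / ϑ + T) * ((F z ^ 2 + Real.exp (2 * ϑ * P.hamiltonian N z)) / 2) *
            Real.exp (-c * (t.toNNReal : ℝ)) := by gcongr
  have h1 : ∫ z, F z * (∫ t in S, kinAct ω₂ lam β γ T N b t z) ∂ν =
      ∫ z, (∫ t in S, F z * kinAct ω₂ lam β γ T N b t z) ∂ν := by
    refine integral_congr_ae (Eventually.of_forall fun z => ?_)
    dsimp only
    rw [integral_const_mul]
  rw [h1, integral_integral_swap hprod]

/-- **The shift identity** (resolvent equation at `λ = 0`, no generator needed): for `t ≥ 0`,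
`P_t h_b(z) = h_b(z) − ∫₀ᵗ v_s(z) ds` — Fubini for `P_t(z,·) ⊗ ds`, Chapman–Kolmogorov, `s ↦ s + t`,
`∫_{(t,∞)} = ∫_{(0,∞)} − ∫₀ᵗ`. [folklore] -/
theorem act_kinCorrector_eq (hω : 0 < ω₂) (hl : 0 ≤ lam) (hβ : 0 < β) (hγ : 0 < γ) (hN : 0 < N) (hT : 0 < T)
    {ϑ K c : ℝ} (hϑ0 : 0 < ϑ) (h2ϑ : 2 * ϑ < 1 / T) (hK : 0 ≤ K) (hb : ∀ (z : PhaseSpace N) (t : ℝ≥0) (f : PhaseSpace N → ℝ), Continuous f → ∀ C : ℝ, 0 ≤ C →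
      (∀ y, |f y| ≤ C * Real.exp (ϑ * (pinnedChain ω₂ lam β γ).hamiltonian N y)) →
      |(∫ y, f y ∂((pinnedChain ω₂ lam β γ).transitionKernel N T T t z)) -
          ∫ y, f y ∂((pinnedChain ω₂ lam β γ).gibbsMeasure N T)| ≤
        K * C * Real.exp (ϑ * (pinnedChain ω₂ lam β γ).hamiltonian N z) * Real.exp (-c * t)) (hc : 0 < c)
    (b : Fin N) {t : ℝ} (ht : 0 ≤ t) (z : PhaseSpace N) :
    ∫ y, kinCorrector ω₂ lam β γ T N b y ∂((pinnedChain ω₂ lam β γ).transitionKernel N T T t.toNNReal z) =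
      kinCorrector ω₂ lam β γ T N b z - ∫ s in (0 : ℝ)..t, kinAct ω₂ lam β γ T N b s z := by
  set P := pinnedChain ω₂ lam β γ with hP
  have h2ϑ0 : 0 < 2 * ϑ := by positivity
  haveI : IsMarkovKernel (P.transitionKernel N T T t.toNNReal) :=
    pinnedChain_isMarkovKernel_transitionKernel hω hl hβ.le hγ.le N T T _
  have hν : Integrable (fun y => Real.exp (2 * ϑ * P.hamiltonian N y)) (P.transitionKernel N T T t.toNNReal z) :=
    pinnedChain_integrable_exp_mul_hamiltonian_transitionKernel hω hl hT hβ.le hγ.le hN h2ϑ0 h2ϑ _ z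
  have hone : Integrable (fun _ : PhaseSpace N => (1 : ℝ) ^ 2) (P.transitionKernel N T T t.toNNReal z) :=
    integrable_const _
  have h1 := integral_mul_setIntegral_kinAct hω hl hβ.le hγ.le hT hϑ0 hK hb hc b (P.transitionKernel N T T t.toNNReal z)
    hν stronglyMeasurable_const hone (S := Ioi 0) Subset.rfl
  simp only [one_mul] at h1
  unfold kinCorrector
  rw [h1]
  -- Chapman–Kolmogorov under the time integral
  have h2 : ∀ s ∈ Ioi (0 : ℝ), ∫ y, kinAct ω₂ lam β γ T N b s y ∂(P.transitionKernel N T T t.toNNReal z) =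
      kinAct ω₂ lam β γ T N b (s + t) z :=
    fun s hs => act_kinAct_eq hω hl hβ.le hγ.le hN hT b (le_of_lt hs) ht z
  rw [setIntegral_congr_fun measurableSet_Ioi h2,
    setIntegral_Ioi_comp_add_right (fun s => kinAct ω₂ lam β γ T N b s z) t]
  -- `∫_{(t,∞)} = ∫_{(0,∞)} − ∫₀ᵗ`
  have hI0 := (kinAct_integrableOn hω hl hβ hγ hT hϑ0 hb hc b z).1
  have hIt : IntegrableOn (fun s => kinAct ω₂ lam β γ T N b s z) (Ioi t) := hI0.mono_set (Ioi_subset_Ioi ht)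
  have hsplit := intervalIntegral.integral_interval_add_Ioi hI0 hIt
  linarith

end Pinned

end Summit.AtomisticToContinuum.FouriersLaw.Theorems.BoundedResponse.ParityFloor

end
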